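import Literature.AlgebraicGeometry.Morphisms.GraphFamilyLettersTransport
import HarnessLib

/-!
# The Hilbert letters of the graphs of all fibre isomorphisms `G : (Y₁)_t ⥲ (Y₂)_t` with `G^*𝒪_{j₂}(1)| ≅ 𝒪_{j₁}(1)|` form a FINITE set

Layer `Literature/AlgebraicGeometry/Morphisms`, namespace `Literature.AlgebraicGeometry.Morphisms`.  THEOREMS ONLY (no definition, no named fact, no
instance, no notation, no `sorry`); universe `0`.  Cell `hodgecm-mathlib` (D-0151), P6 «MOD programme», organ «stub_ILET» FILE B2 head (B-p10 (g29);
road = A-p14 (g34)); sequel of ★ `Morphisms/GraphFamilyLettersTransport` (§1 class of `k^*𝒪_Γ(e)`, §2 reference letters + transfer).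
The line `Cruxes/HLiu418/Lines/F0_P6a_IsomSchemeFiniteType.lean` reads the head with `Yᵢ := 𝒜ᵢ.X`, `Nᵢ := L^Δ(λᵢ)^{⊗k}`, `G` over `t` from
`TupleIsoVia` and the iso of ★ `nonempty_pullback_LDelta_tensorPow_iso_of_tupleIso`; the line's `def`s `GraphLetters`∕`prodEmb` are spelled out
VERBATIM (a Lines file is not importable), so `stub_ILET` closes by `obtain ⟨F, hF⟩ := …; exact ⟨F, …⟩` modulo `δ`-unfolding.
Count-neutral: HC_CM is proved only modulo the printed citations until rung 0 closes.

* **`exists_finset_graphLetters_of_pullback_iso`** — `Y` Noetherian, `Yᵢ → Y` flat, `jᵢ : Yᵢ ↪ 𝐏(Fin n; Y)` closed `Y`-immersions with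
  `𝒪_{jᵢ}(1) ≅ Nᵢ` of rank one, `1 ≤ n`: a FINITE `F ⊆ ℚ[X] × ℚ[X]` carrying, for every field point `t` and `t`-morphism `G` with `G^*(N₂|) ≅ N₁|`,
  the letters of every graph family of `G` through `σ₁₂` and of every two-sided inverse `Ginv` through `σ₂₁` (`F :=` range of `y ↦ (P₁ y, P₂ y)` for
  the reference letter functions of ★ `exists_refLetters`, finite on the compact `Y` by Mathlib `IsLocallyConstant.range_finite`; transfer by ★
  `graphLetters_of_refLetters`, for `Ginv` via `Ginv^*(N₁|) ≅ Ginv^*G^*(N₂|) ≅ N₂|` in classes).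

## References
* [MumfordFogartyKirwan1994] D. Mumford, J. Fogarty, F. Kirwan, *Geometric Invariant Theory*, 3rd ed. (1994), Ch. 0 §5 (c) (p. 23), Ch. 7 §2 Prop. 7.3 (p. 132).
* [EGAIII2] A. Grothendieck, J. Dieudonné, *EGA III₂* (1963), 7.9.11.
* [Hartshorne1977] R. Hartshorne, *Algebraic Geometry* (1977), II Thm. 7.1 (p. 150), III Thm. 9.9 (p. 261).
-/

noncomputable section

-- `TopCat.Presheaf`/`Scheme.Modules` bookkeeping (as in ★ `Morphisms/GraphFamilyHilbertPolynomial`).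
set_option backward.isDefEq.respectTransparency false

open CategoryTheory CategoryTheory.Limits CategoryTheory.Abelian AlgebraicGeometry TopologicalSpace Opposite MonoidalCategory Polynomial

namespace Literature.AlgebraicGeometry.Morphisms

open Literature.AlgebraicGeometry.Modules Literature.AlgebraicGeometry.Modules.SerreTwist Literature.AlgebraicGeometry.Motives
open Literature.AlgebraicGeometry.Morphisms.ProjCech Literature.Algebra.Homology Literature.Algebra.Homology.LaurentCech

/-! ## §3 The head -/

section Head

variable {Y : Scheme.{0}} [IsNoetherian Y] (Y₁ Y₂ : Over Y) [Flat Y₁.hom] [Flat Y₂.hom] {n : ℕ} (hn : 1 ≤ n)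
  (j₁ : Y₁.left ⟶ Morphisms.projectiveSpace (Fin n) Y) (hj₁ : j₁ ≫ Morphisms.projectiveSpaceFst (Fin n) Y = Y₁.hom)
  (j₂ : Y₂.left ⟶ Morphisms.projectiveSpace (Fin n) Y) (hj₂ : j₂ ≫ Morphisms.projectiveSpaceFst (Fin n) Y = Y₂.hom)
  [IsClosedImmersion j₁] [IsClosedImmersion j₂]
  {N₁ : Y₁.left.Modules} {N₂ : Y₂.left.Modules} (hN₁ : HasRank N₁ 1) (hN₂ : HasRank N₂ 1)
  (ψ₁ : twistMod (j₁ ≫ pullback.snd (terminal.from Y) (terminal.from (Morphisms.projectiveSpaceInt (Fin n)))) (unitModule _) 1 ≅ N₁)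
  (ψ₂ : twistMod (j₂ ≫ pullback.snd (terminal.from Y) (terminal.from (Morphisms.projectiveSpaceInt (Fin n)))) (unitModule _) 1 ≅ N₂)

include hn hN₁ hN₂ ψ₁ ψ₂ in
/-- **THE HILBERT LETTERS OF THE GRAPHS OF FIBRE ISOMORPHISMS IDENTIFYING THE `𝒪(1)`'S FORM A FINITE SET.**  `Y` Noetherian; `Y₁, Y₂ → Y` flat;
closed `Y`-immersions `jᵢ : Yᵢ ↪ 𝐏(Fin n; Y)` (`1 ≤ n`) with `𝒪_{jᵢ}(1) ≅ Nᵢ` of rank one.  THEN a FINITE `F ⊆ ℚ[X] × ℚ[X]` has: for every field point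
`t : Spec Ω → Y` and every `t`-morphism `G : (Y₁)_t → (Y₂)_t` with `G^*(N₂|) ≅ N₁|`, some `(Q, Q′) ∈ F` such that EVERY graph family `iΓ` of `G` through
`σ₁₂ = ((j₁ ⊗ j₂) ≫ segreOver).left` has, at every field point `(k, f₀, x)` and every `e ≥ B(Q) − 1`, `Ext¹(𝒪, k^*𝒪_Γ(e)) = 0` and `dim Γ(k^*𝒪_Γ(e)) = Q(e)`
(VERBATIM the body of the line's `GraphLetters`), and every graph family of every two-sided inverse `Ginv` through `σ₂₁` the letters `Q′`.  PROOF: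
`(Q, Q′) := (P₁ y, P₂ y)`, `y` the point under `t`, `Pᵢ` the reference letter functions of §2 (finitely many values on the compact `Y`); transfer by
`graphLetters_of_refLetters`, for `Ginv` with `Ginv^*(N₁|) ≅ Ginv^*G^*(N₂|) ≅ N₂|`.
[cite: MumfordFogartyKirwan1994, Ch. 0 §5 (c) (p. 23) and Ch. 7 §2 Prop. 7.3 (p. 132)] [cite: EGAIII2, 7.9.11] [cite: Hartshorne1977, III Thm. 9.9 (p. 261)] -/
theorem exists_finset_graphLetters_of_pullback_iso :
    ∃ F : Finset (ℚ[X] × ℚ[X]), ∀ ⦃Ω : Type⦄ [Field Ω] (t : Spec (CommRingCat.of Ω) ⟶ Y)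
      (G : pullback Y₁.hom t ⟶ pullback Y₂.hom t), G ≫ pullback.snd Y₂.hom t = pullback.snd Y₁.hom t →
      Nonempty ((Scheme.Modules.pullback G).obj ((Scheme.Modules.pullback (pullback.fst Y₂.hom t)).obj N₂) ≅
        (Scheme.Modules.pullback (pullback.fst Y₁.hom t)).obj N₁) →
      ∃ QQ' ∈ F,
        (∀ (hw : pullback.fst Y₁.hom t ≫ Y₁.hom = (G ≫ pullback.fst Y₂.hom t) ≫ Y₂.hom)
            (iΓ : pullback Y₁.hom t ⟶ Morphisms.projectiveSpace (Fin (n * n + n + n)) (Spec (CommRingCat.of Ω))),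
          iΓ ≫ Morphisms.projectiveSpaceFst (Fin (n * n + n + n)) (Spec (CommRingCat.of Ω)) = pullback.snd Y₁.hom t →
          iΓ ≫ Morphisms.projectiveSpaceMap (Fin (n * n + n + n)) t =
            pullback.lift (pullback.fst Y₁.hom t) (G ≫ pullback.fst Y₂.hom t) hw ≫
              ((Over.homMk j₁ hj₁ ⊗ₘ Over.homMk j₂ hj₂ :
                Y₁ ⊗ Y₂ ⟶ Over.mk (Morphisms.projectiveSpaceFst (Fin n) Y) ⊗ Over.mk (Morphisms.projectiveSpaceFst (Fin n) Y)) ≫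
                Morphisms.segreOver Y (Morphisms.segreIndexEquivFin n n)).left →
          ∀ ⦃K : Type⦄ [Field K] ⦃X' : Scheme.{0}⦄ (k : X' ⟶ pullback Y₁.hom t) (f₀ : X' ⟶ Spec (CommRingCat.of K))
            (x : Spec (CommRingCat.of K) ⟶ Spec (CommRingCat.of Ω)),
            IsPullback k f₀ (iΓ ≫ Morphisms.projectiveSpaceFst (Fin (n * n + n + n)) (Spec (CommRingCat.of Ω))) x →
            ∀ e : ℕ, regularityBound (preHilbertPoly ℚ (Nat.card (Fin (n * n + n + n))) 0) 0
                (preHilbertPoly ℚ (Nat.card (Fin (n * n + n + n))) 0 - QQ'.1) - 1 ≤ (e : ℤ) →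
              Subsingleton (CategoryTheory.Abelian.Ext.{1} (unitModule X') ((Scheme.Modules.pullback k).obj
                (twistMod (iΓ ≫ pullback.snd (terminal.from (Spec (CommRingCat.of Ω)))
                  (terminal.from (Morphisms.projectiveSpaceInt (Fin (n * n + n + n))))) (unitModule _) e)) 1) ∧
              ((Module.finrank Γ(Spec (CommRingCat.of K), ⊤) (SecMod ((Scheme.Modules.pullback k).obj
                (twistMod (iΓ ≫ pullback.snd (terminal.from (Spec (CommRingCat.of Ω)))
                  (terminal.from (Morphisms.projectiveSpaceInt (Fin (n * n + n + n))))) (unitModule _) e))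
                f₀.appTop.hom ⊤) : ℕ) : ℚ) = QQ'.1.eval (e : ℚ)) ∧
        ∀ Ginv : pullback Y₂.hom t ⟶ pullback Y₁.hom t, Ginv ≫ G = 𝟙 _ → G ≫ Ginv = 𝟙 _ →
          ∀ (hw : pullback.fst Y₂.hom t ≫ Y₂.hom = (Ginv ≫ pullback.fst Y₁.hom t) ≫ Y₁.hom)
            (iΓ : pullback Y₂.hom t ⟶ Morphisms.projectiveSpace (Fin (n * n + n + n)) (Spec (CommRingCat.of Ω))),
          iΓ ≫ Morphisms.projectiveSpaceFst (Fin (n * n + n + n)) (Spec (CommRingCat.of Ω)) = pullback.snd Y₂.hom t →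
          iΓ ≫ Morphisms.projectiveSpaceMap (Fin (n * n + n + n)) t =
            pullback.lift (pullback.fst Y₂.hom t) (Ginv ≫ pullback.fst Y₁.hom t) hw ≫
              ((Over.homMk j₂ hj₂ ⊗ₘ Over.homMk j₁ hj₁ :
                Y₂ ⊗ Y₁ ⟶ Over.mk (Morphisms.projectiveSpaceFst (Fin n) Y) ⊗ Over.mk (Morphisms.projectiveSpaceFst (Fin n) Y)) ≫
                Morphisms.segreOver Y (Morphisms.segreIndexEquivFin n n)).left →
          ∀ ⦃K : Type⦄ [Field K] ⦃X' : Scheme.{0}⦄ (k : X' ⟶ pullback Y₂.hom t) (f₀ : X' ⟶ Spec (CommRingCat.of K))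
            (x : Spec (CommRingCat.of K) ⟶ Spec (CommRingCat.of Ω)),
            IsPullback k f₀ (iΓ ≫ Morphisms.projectiveSpaceFst (Fin (n * n + n + n)) (Spec (CommRingCat.of Ω))) x →
            ∀ e : ℕ, regularityBound (preHilbertPoly ℚ (Nat.card (Fin (n * n + n + n))) 0) 0
                (preHilbertPoly ℚ (Nat.card (Fin (n * n + n + n))) 0 - QQ'.2) - 1 ≤ (e : ℤ) →
              Subsingleton (CategoryTheory.Abelian.Ext.{1} (unitModule X') ((Scheme.Modules.pullback k).obj
                (twistMod (iΓ ≫ pullback.snd (terminal.from (Spec (CommRingCat.of Ω)))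
                  (terminal.from (Morphisms.projectiveSpaceInt (Fin (n * n + n + n))))) (unitModule _) e)) 1) ∧
              ((Module.finrank Γ(Spec (CommRingCat.of K), ⊤) (SecMod ((Scheme.Modules.pullback k).obj
                (twistMod (iΓ ≫ pullback.snd (terminal.from (Spec (CommRingCat.of Ω)))
                  (terminal.from (Morphisms.projectiveSpaceInt (Fin (n * n + n + n))))) (unitModule _) e))
                f₀.appTop.hom ⊤) : ℕ) : ℚ) = QQ'.2.eval (e : ℚ) := by
  classical
  obtain ⟨P₁, iΓ₁, hw₁, hP₁lc, h₁₁, h₁₂, hP₁⟩ := exists_refLetters Y₁ j₁ hj₁ hn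
  obtain ⟨P₂, iΓ₂, hw₂, hP₂lc, h₂₁, h₂₂, hP₂⟩ := exists_refLetters Y₂ j₂ hj₂ hn
  have hfin : (Set.range fun y : Y ↦ (P₁ y, P₂ y)).Finite := (hP₁lc.prodMk hP₂lc).range_finite
  refine ⟨hfin.toFinset, fun Ω _ t G _ χ ↦ ⟨(P₁ (t.base (IsLocalRing.closedPoint Ω)), P₂ (t.base (IsLocalRing.closedPoint Ω))),
    hfin.mem_toFinset.2 ⟨_, rfl⟩, fun hw iΓ h₁ h₂ K _ X' k f₀ x hk e he ↦
      graphLetters_of_refLetters Y₁ Y₂ j₁ hj₁ j₂ hj₂ hN₁ hN₂ ψ₁ ψ₂ P₁ iΓ₁ h₁₁ hw₁ h₁₂ hP₁ t G χ hw iΓ h₁ h₂ k f₀ x hk e he,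
    fun Ginv hi₁ _ hw iΓ h₁ h₂ K _ X' k f₀ x hk e he ↦ ?_⟩⟩
  -- `Ginv^*(N₁|) ≅ Ginv^*G^*(N₂|) ≅ N₂|`
  have χ' : Nonempty ((Scheme.Modules.pullback Ginv).obj ((Scheme.Modules.pullback (pullback.fst Y₁.hom t)).obj N₁) ≅
      (Scheme.Modules.pullback (pullback.fst Y₂.hom t)).obj N₂) := by
    obtain ⟨χ⟩ := χ
    have h1f := HasRank.isFiniteLocallyFree' hN₁
    have h2f := HasRank.isFiniteLocallyFree' hN₂
    have eχ : CechPic.pullback G (CechPic.pullback (pullback.fst Y₂.hom t) (detClass h2f)) =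
        CechPic.pullback (pullback.fst Y₁.hom t) (detClass h1f) := by
      rw [← detClass_pullback (pullback.fst Y₂.hom t) h2f, ← detClass_pullback G (h2f.pullback _),
        ← detClass_pullback (pullback.fst Y₁.hom t) h1f]
      exact detClass_eq_of_iso χ _ _
    refine (nonempty_iso_iff_detClass_eq (hasRank_pullback _ (hasRank_pullback _ hN₁)) (hasRank_pullback _ hN₂)
      ((h1f.pullback _).pullback Ginv) (h2f.pullback _)).2 ?_
    rw [detClass_pullback Ginv (h1f.pullback _), detClass_pullback _ h1f, detClass_pullback _ h2f, ← eχ, ← CechPic.pullback_comp, hi₁,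
      ← CechPic.pullback_comp, Category.id_comp]
  exact graphLetters_of_refLetters Y₂ Y₁ j₂ hj₂ j₁ hj₁ hN₂ hN₁ ψ₂ ψ₁ P₂ iΓ₂ h₂₁ hw₂ h₂₂ hP₂ t Ginv χ' hw iΓ h₁ h₂ k f₀ x hk e he

end Head

end Literature.AlgebraicGeometry.Morphisms

end
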